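import Summits.QuantumFields.BalabanUV.Beta.SymAveragingMixedJetTables
import Summits.QuantumFields.BalabanUV.Beta.SymAveragingHessianCounts
import Summits.QuantumFields.BalabanUV.Beta.WardSiteToBlock

/-!
# `BalabanUV.Beta.SymWardSiteToBlock` — THE TWO SITE-TO-BOND BLOCK SUMS OF WX5 FOR THE (0.4)-SYMMETRISED KERNELS `symVh2KerAt`, `symMixKerAt` AT ROOT `ctr 4 Lc`
# (β sub-cell, row D1, TABLES-SYM-LEAN S2c∕S2d, KERNEL-LEVEL twin of the row owner's WX5 `WardSiteToBlock`; an1 gen 43; both Ward paths)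

HONEST FRAMING (cell charter, verbatim): «discharging BetaPertH makes Bałaban's UV stability UNCONDITIONAL — a real
constructive-QFT result; it is NOT the continuum limit and NOT the Clay problem.»  HONEST DEPENDENCY (verbatim): «continuum YM on
T⁴ ⇐ BetaPertH ∧ nine spine estimates (0/9 proved); BetaPertH ⇐ (D1) ∧ (D4) ∧ CAP+tail; G-an2-4 gates asym, D1 and NE2/3/4.»
ABSOLUTE RULE (R-g25-7 ∕ R-D1-g30-1 (A)): the (0.4)-symmetrised averaging is the exp of the MEAN OF LOGS over the pair family
`{loop^{σ,σ′}}` with weight `((d!)²·L^d)⁻¹`; every object below is the comb module's algebra read on an1's `symPhiGAt` (S2b part 1)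
instead of `PhiGAt` — STATEMENT FOR STATEMENT under the dictionary `PhiXAt ↦ symPhiXAt`, `XjetAt ↦ symXjetAt`, `MσXAt ↦ symMσXAt`,
`L^{-d}·linAvgAt ↦ (d!·L^d)⁻¹·symLinU`, `L^{-d}·hessUAt ↦ ((d!)²L^d)⁻¹·symHessUAt`, `L^{-2d}·vhUAt ↦ ((d!)²L^{2d})⁻¹·symVhUAt`
(an3-g63 [AN3-G63-S2C] (C-ii): constants PER BCH ORDER; CONVENTION `(d!)²` un-normalised inside order-2 sym functionals).
FAMILY-INDEPENDENT chart ∕ letter ∕ `Tau`-algebra lemmas of the comb module are imported BY NAME, never re-proved.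
DERIVED cell leaf: [folklore] ring algebra; the `sym*` families are [our object]s.  No statement of Bałaban's papers is typed here, no
`[cite:]` tag, no `Prop` is minted, no binder of the β-function wall (`hW`/`hR`/`D1Tel`/`D1Rep`, (D1), `BetaPertH`) is instantiated or
discharged; nothing about the VALUES of `symMixFFAt`∕`symVh₂SAt` and no (T2-B)∕(T2-M₂) letter is discharged in this file.
NOT D1, NOT BetaPertH, NOT continuum, NOT Clay.  NOT summit progress.
Provenance: β sub-cell, TABLES-SYM-LEAN S2c option (C) (S2C-SCOPE-v1 94facb80ac685517), unit b2b-balaban-beta-an1-g43 (W-supplier AN1,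
FREEZE (0): scratch for a courier; an1 files nothing), 2026-08-21; no existing file touched.

## What this module proves (sym twin of `WardSiteToBlock`'s two block lemmas; its corollary `symmetries_JsRowD1Pin_of_siteLaws` concerns the COMB
## literal `JsRowD1Pin` and is NOT twinned — the sym root `RowD1JointEndSymReflTablesAn1S2` consumes the bond identities through its own letters)
* **`symBondWardB_of_symSiteWardB`** (`Lc` odd): the sym SITE border Ward law (W2-B)_sym «`Σ_κ (Ssym(f;(κ,u−e_κ),h) − Ssym(f;(κ,u),h)) = symVhKerAt(f,h)·([u = r] −
  [u = x_f])`» at root `r = Lc•y + ctr 4 Lc` ⟹ the border Ward BOND identity at lockB `cB := −Lc¹²∕4` (same weight arithmetic as WX5: `z = Lc•blk z` on the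
  coarse lattice, `stepScale 3 Lc 0 = 1`, `(Lc⁴)⁻¹·(−Lc¹²∕4) = ½·(−Lc⁴·½·Lc⁴)`).
* **`symBondWardM_of_symSiteWardM`**: the sym SITE mixed Ward law (W2-M)_sym «`Σ_κ (t_sym(f,f′;(κ,u−e_κ)) − t_sym(f,f′;(κ,u))) = 2·symHessKerAt(f,f′)·([u = r] −
  [u = x_f])`» ⟹ the mixed Ward BOND identity (WM-bond)_sym at the Λ-lock `cΛ := 2∕Lc⁴` (the root terms cancel in the f↔f′-symmetrisation by the LANDED
  `SymAveragingHessianCounts.symHessKerAt_swap`).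
Both are HYPOTHESIS-SHAPED implications (finite-sum bookkeeping, kernel currency); the site laws themselves are theorems of an1's `SymMixedWardSiteLaw.symSiteWardM`
and `SymBorderWardSiteLaw.symSiteWardB` (this lineage, S2d). Root token: `ctr 4 Lc` (= `toSite (ctrOff 4 Lc)` by `rfl`, the sym root's spelling).
-/

open Finset
open scoped BigOperators
open Literature.MathematicalPhysics.QuantumFieldTheory.Balaban1983to89
open Literature.MathematicalPhysics.QuantumFieldTheory.Balaban1983to89.Beta
open ExpKernelCalculus (MKer)
open AffineAveraging (box toSite)
open AveragingContours (blk off)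
open AveragingContoursRooted (ctr ctrOff)
open Summit.QuantumFields.BalabanUV.Beta.SymAveragingHessianCounts (symVhKerAt symLinKerAt symHessKerAt symHessKerAt_swap)
open Summit.QuantumFields.BalabanUV.Beta.SymAveragingMixedJetTables (symVh2KerAt symMixKerAt)
open PolarizationSign (reflSign WardTransversal AxisReflectionCovariant)
open ResolventReflection (bref)
open RootedKernelReflection (eq_zsmul_blk_of_off)
open OneStepResolventKernel (Fib JetData)
open OneStepKernelFamily (TbalOf flipK D1Tel D1Rep D1Drift)
open Literature.MathematicalPhysics.QuantumFieldTheory.Balaban1983to89.Beta.VectorTailsLoc (fam kfam)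
open Literature.MathematicalPhysics.QuantumFieldTheory.Balaban1983to89.Beta.VectorLegVolumeAdapter (MvE)
open B6BondElimination (unitVec)
open BalabanStepJetsSucc (wVH)
open Summit.QuantumFields.BalabanUV.Beta.BorderedHessian (stepScale)
open Summit.QuantumFields.BalabanUV.Beta.RowD1JointEnd (JsRowD1Pin)

namespace Summit.QuantumFields.BalabanUV.Beta.SymWardSiteToBlock

noncomputable section

variable {Lc : ℕ} [NeZero Lc]

/-- [folklore] **(W2-B) ⟹ THE BORDER WARD BOND IDENTITY `hWb` AT lockB** `cB = −Lc¹²∕4` (WX4's `hW` ∕ RX's `hWb`, token for token). -/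
theorem symBondWardB_of_symSiteWardB (hLc : Odd Lc)
    (hS : ∀ (u : Fin 4 → ℤ) (m : Fin 4) (y : Fin 4 → ℤ) (β : Fin 4) (x : Fin 4 → ℤ) (κ' : Fin 4) (u' : Fin 4 → ℤ),
      ∑ κ : Fin (3 + 1),
          ((1 / 2 : ℝ) * (symVh2KerAt (ctr 4 Lc) Lc m y (β, x) (κ, u - unitVec κ) (κ', u')
              + symVh2KerAt (ctr 4 Lc) Lc m y (β, x) (κ', u') (κ, u - unitVec κ))
            - (1 / 2 : ℝ) * (symVh2KerAt (ctr 4 Lc) Lc m y (β, x) (κ, u) (κ', u')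
              + symVh2KerAt (ctr 4 Lc) Lc m y (β, x) (κ', u') (κ, u))) =
        symVhKerAt (ctr 4 Lc) Lc m y (β, x) (κ', u')
          * ((if u = (Lc : ℤ) • y + ctr 4 Lc then (1 : ℝ) else 0) - (if u = x then (1 : ℝ) else 0))) :
    ∀ (Y : Fin 4 → ℤ) (κ' : Fin 4) (u' x z : Fin 4 → ℤ) (β m : Fin 4), off Lc z = 0 →
      (stepScale 3 Lc 0 * (Lc : ℝ) ^ (3 + 1))⁻¹ *
          ∑ v ∈ box (3 + 1) Lc, ∑ κ : Fin (3 + 1),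
            ((-((Lc : ℝ) ^ 12 / 4)) * ((1 / 2 : ℝ) * (symVh2KerAt (ctr 4 Lc) Lc m (blk Lc z) (β, x) (κ, (Lc : ℤ) • Y + toSite v - unitVec κ) (κ', u')
                + symVh2KerAt (ctr 4 Lc) Lc m (blk Lc z) (β, x) (κ', u') (κ, (Lc : ℤ) • Y + toSite v - unitVec κ)))
              - (-((Lc : ℝ) ^ 12 / 4)) * ((1 / 2 : ℝ) * (symVh2KerAt (ctr 4 Lc) Lc m (blk Lc z) (β, x) (κ, (Lc : ℤ) • Y + toSite v) (κ', u')
                + symVh2KerAt (ctr 4 Lc) Lc m (blk Lc z) (β, x) (κ', u') (κ, (Lc : ℤ) • Y + toSite v)))) =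
        (-((Lc : ℝ) ^ (3 + 1) * (1 / 2) * (Lc : ℝ) ^ (3 + 1))) * symVhKerAt (ctr 4 Lc) Lc m (blk Lc z) (β, x) (κ', u')
            * ((1 / 2 : ℝ) * ∑ v ∈ box (3 + 1) Lc, (if z + ctr 4 Lc = (Lc : ℤ) • Y + toSite v then (1 : ℝ) else 0))
          - ((1 / 2 : ℝ) * ∑ v ∈ box (3 + 1) Lc, (if x = (Lc : ℤ) • Y + toSite v then (1 : ℝ) else 0))
            * ((-((Lc : ℝ) ^ (3 + 1) * (1 / 2) * (Lc : ℝ) ^ (3 + 1))) * symVhKerAt (ctr 4 Lc) Lc m (blk Lc z) (β, x) (κ', u')) := by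
  intro Y κ' u' x z β m hz
  have hL : (Lc : ℝ) ≠ 0 := by exact_mod_cast NeZero.ne Lc
  have h0 : stepScale 3 Lc 0 = 1 := by simp [BorderedHessian.stepScale]
  -- on the coarse lattice the root of `b = (m, blk z)` is `z + ρ_c`
  have hzb : (Lc : ℤ) • blk Lc z = z := (eq_zsmul_blk_of_off hLc.pos hz).symm
  -- the inner `κ`-sum at each `v`, by the site law at `u := Lc•Y + v`
  have hv : ∀ v ∈ box (3 + 1) Lc, ∑ κ : Fin (3 + 1),
      ((-((Lc : ℝ) ^ 12 / 4)) * ((1 / 2 : ℝ) * (symVh2KerAt (ctr 4 Lc) Lc m (blk Lc z) (β, x) (κ, (Lc : ℤ) • Y + toSite v - unitVec κ) (κ', u')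
          + symVh2KerAt (ctr 4 Lc) Lc m (blk Lc z) (β, x) (κ', u') (κ, (Lc : ℤ) • Y + toSite v - unitVec κ)))
        - (-((Lc : ℝ) ^ 12 / 4)) * ((1 / 2 : ℝ) * (symVh2KerAt (ctr 4 Lc) Lc m (blk Lc z) (β, x) (κ, (Lc : ℤ) • Y + toSite v) (κ', u')
          + symVh2KerAt (ctr 4 Lc) Lc m (blk Lc z) (β, x) (κ', u') (κ, (Lc : ℤ) • Y + toSite v)))) =
      (-((Lc : ℝ) ^ 12 / 4)) * (symVhKerAt (ctr 4 Lc) Lc m (blk Lc z) (β, x) (κ', u')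
        * ((if z + ctr 4 Lc = (Lc : ℤ) • Y + toSite v then (1 : ℝ) else 0) - (if x = (Lc : ℤ) • Y + toSite v then (1 : ℝ) else 0))) := by
    intro v _
    have h := hS ((Lc : ℤ) • Y + toSite v) m (blk Lc z) β x κ' u'
    rw [hzb] at h
    have e : ∀ κ : Fin (3 + 1),
        (-((Lc : ℝ) ^ 12 / 4)) * ((1 / 2 : ℝ) * (symVh2KerAt (ctr 4 Lc) Lc m (blk Lc z) (β, x) (κ, (Lc : ℤ) • Y + toSite v - unitVec κ) (κ', u')
            + symVh2KerAt (ctr 4 Lc) Lc m (blk Lc z) (β, x) (κ', u') (κ, (Lc : ℤ) • Y + toSite v - unitVec κ)))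
          - (-((Lc : ℝ) ^ 12 / 4)) * ((1 / 2 : ℝ) * (symVh2KerAt (ctr 4 Lc) Lc m (blk Lc z) (β, x) (κ, (Lc : ℤ) • Y + toSite v) (κ', u')
            + symVh2KerAt (ctr 4 Lc) Lc m (blk Lc z) (β, x) (κ', u') (κ, (Lc : ℤ) • Y + toSite v))) =
        (-((Lc : ℝ) ^ 12 / 4)) * (((1 / 2 : ℝ) * (symVh2KerAt (ctr 4 Lc) Lc m (blk Lc z) (β, x) (κ, (Lc : ℤ) • Y + toSite v - unitVec κ) (κ', u')
            + symVh2KerAt (ctr 4 Lc) Lc m (blk Lc z) (β, x) (κ', u') (κ, (Lc : ℤ) • Y + toSite v - unitVec κ)))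
          - (1 / 2 : ℝ) * (symVh2KerAt (ctr 4 Lc) Lc m (blk Lc z) (β, x) (κ, (Lc : ℤ) • Y + toSite v) (κ', u')
            + symVh2KerAt (ctr 4 Lc) Lc m (blk Lc z) (β, x) (κ', u') (κ, (Lc : ℤ) • Y + toSite v))) := fun κ => by ring
    rw [Finset.sum_congr rfl (fun κ _ => e κ), ← Finset.mul_sum, h]
    -- orientation of the two indicator tests
    have e1 : (if (Lc : ℤ) • Y + toSite v = z + ctr 4 Lc then (1 : ℝ) else 0) =
        (if z + ctr 4 Lc = (Lc : ℤ) • Y + toSite v then (1 : ℝ) else 0) := by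
      by_cases h' : z + ctr 4 Lc = (Lc : ℤ) • Y + toSite v
      · rw [if_pos h', if_pos h'.symm]
      · rw [if_neg h', if_neg (fun h'' => h' h''.symm)]
    have e2 : (if (Lc : ℤ) • Y + toSite v = x then (1 : ℝ) else 0) = (if x = (Lc : ℤ) • Y + toSite v then (1 : ℝ) else 0) := by
      by_cases h' : x = (Lc : ℤ) • Y + toSite v
      · rw [if_pos h', if_pos h'.symm]
      · rw [if_neg h', if_neg (fun h'' => h' h''.symm)]
    rw [e1, e2]
  rw [Finset.sum_congr rfl hv, ← Finset.mul_sum, h0]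
  simp only [mul_sub, Finset.sum_sub_distrib, ← Finset.mul_sum]
  field_simp
  ring

/-- [folklore] **(W2-M) ⟹ THE MIXED WARD BOND IDENTITY (WM-bond) AT THE Λ-LOCK** `cΛ = 2∕Lc⁴` (the row owner's K-W1 hypothesis `hWM`, token for
token): in the f↔f′-symmetrisation the ROOT indicators cancel (the LANDED `symHessKerAt_swap`) and the two row-leg indicators survive. -/
theorem symBondWardM_of_symSiteWardM
    (hS : ∀ (u : Fin 4 → ℤ) (ρ' : Fin 4) (w : Fin 4 → ℤ) (β : Fin 4) (x : Fin 4 → ℤ) (β' : Fin 4) (x' : Fin 4 → ℤ),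
      ∑ κ : Fin (3 + 1),
          (symMixKerAt (ctr 4 Lc) Lc ρ' w (κ, u - unitVec κ) (β, x) (β', x')
            - symMixKerAt (ctr 4 Lc) Lc ρ' w (κ, u) (β, x) (β', x')) =
        2 * symHessKerAt (ctr 4 Lc) Lc ρ' w (β, x) (β', x')
          * ((if u = (Lc : ℤ) • w + ctr 4 Lc then (1 : ℝ) else 0) - (if u = x then (1 : ℝ) else 0))) :
    ∀ (y : Fin (3 + 1) → ℤ) (ρ' : Fin (3 + 1)) (w : Fin (3 + 1) → ℤ) (β : Fin (3 + 1)) (x : Fin (3 + 1) → ℤ) (β' : Fin (3 + 1))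
      (x' : Fin (3 + 1) → ℤ),
      ((Lc : ℝ) ^ (3 + 1))⁻¹ * (∑ v ∈ box (3 + 1) Lc, ∑ κ : Fin (3 + 1),
          ((symMixKerAt (ctr 4 Lc) Lc ρ' w (κ, (Lc : ℤ) • y + toSite v - unitVec κ) (β, x) (β', x')
              - symMixKerAt (ctr 4 Lc) Lc ρ' w (κ, (Lc : ℤ) • y + toSite v) (β, x) (β', x'))
            + (symMixKerAt (ctr 4 Lc) Lc ρ' w (κ, (Lc : ℤ) • y + toSite v - unitVec κ) (β', x') (β, x)
              - symMixKerAt (ctr 4 Lc) Lc ρ' w (κ, (Lc : ℤ) • y + toSite v) (β', x') (β, x)))) =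
        2 * ((2 / (Lc : ℝ) ^ 4) * symHessKerAt (ctr 4 Lc) Lc ρ' w (β, x) (β', x') *
          ((1 / 2 : ℝ) * (∑ v ∈ box (3 + 1) Lc, (if x' = (Lc : ℤ) • y + toSite v then (1 : ℝ) else 0))
            - (1 / 2 : ℝ) * (∑ v ∈ box (3 + 1) Lc, (if x = (Lc : ℤ) • y + toSite v then (1 : ℝ) else 0)))) := by
  intro y ρ' w β x β' x'
  have hL : (Lc : ℝ) ≠ 0 := by exact_mod_cast NeZero.ne Lc
  have hsw := symHessKerAt_swap (ctr 4 Lc) Lc ρ' w (β, x) (β', x')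
  have hv : ∀ v ∈ box (3 + 1) Lc, ∑ κ : Fin (3 + 1),
      ((symMixKerAt (ctr 4 Lc) Lc ρ' w (κ, (Lc : ℤ) • y + toSite v - unitVec κ) (β, x) (β', x')
          - symMixKerAt (ctr 4 Lc) Lc ρ' w (κ, (Lc : ℤ) • y + toSite v) (β, x) (β', x'))
        + (symMixKerAt (ctr 4 Lc) Lc ρ' w (κ, (Lc : ℤ) • y + toSite v - unitVec κ) (β', x') (β, x)
          - symMixKerAt (ctr 4 Lc) Lc ρ' w (κ, (Lc : ℤ) • y + toSite v) (β', x') (β, x))) =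
      2 * symHessKerAt (ctr 4 Lc) Lc ρ' w (β, x) (β', x')
        * ((if x' = (Lc : ℤ) • y + toSite v then (1 : ℝ) else 0) - (if x = (Lc : ℤ) • y + toSite v then (1 : ℝ) else 0)) := by
    intro v _
    rw [Finset.sum_add_distrib, hS ((Lc : ℤ) • y + toSite v) ρ' w β x β' x', hS ((Lc : ℤ) • y + toSite v) ρ' w β' x' β x, hsw]
    have e2 : (if (Lc : ℤ) • y + toSite v = x then (1 : ℝ) else 0) = (if x = (Lc : ℤ) • y + toSite v then (1 : ℝ) else 0) := by
      by_cases h' : x = (Lc : ℤ) • y + toSite v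
      · rw [if_pos h', if_pos h'.symm]
      · rw [if_neg h', if_neg (fun h'' => h' h''.symm)]
    have e3 : (if (Lc : ℤ) • y + toSite v = x' then (1 : ℝ) else 0) = (if x' = (Lc : ℤ) • y + toSite v then (1 : ℝ) else 0) := by
      by_cases h' : x' = (Lc : ℤ) • y + toSite v
      · rw [if_pos h', if_pos h'.symm]
      · rw [if_neg h', if_neg (fun h'' => h' h''.symm)]
    rw [e2, e3]
    ring
  rw [Finset.sum_congr rfl hv]
  simp only [mul_sub, Finset.sum_sub_distrib, ← Finset.mul_sum]
  field_simp
  ring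

end

end Summit.QuantumFields.BalabanUV.Beta.SymWardSiteToBlock
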